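import Summits.Ventures.MM22.Rank333.ProfileCertSym
import HarnessLib

/-!
# MM22 venture — PROFILE-CERT kernel replay: matrix algebra of the S-node generators

HONEST FRAMING (cell `pub-mm22`, seat p1 g5; V4-MENU item (0′) «kernel replay of the whole-root PROFILE-CERT»).
Checker PLUMBING with soundness theorems, written from the FROZEN format specification
`HOME/pub-mm22-p2/pcert/PROFILE-CERT-v1-frozen-20260822T2120Z.md` (sha256 59fc6c87…) only. The end declaration of the
chain (`ProfileCertGlue.rankGe21F2_of_pieces`) is an IMPLICATION whose antecedents are Wang's `Cert 3 3 3 [] 20`, a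
certified orbit table (Wang's printed values and the cell's 8 LP/LPDFS lifts), a passing singleton check and the
`NoExt` statement that the (not yet landed) data files assemble to. NOTHING here proves a bound on `R_𝔽₂(⟨3,3,3⟩)`;
no summit claim.

This file: `sigma`/`sigmaInv` as matrices (`ofBits`), inverse witnesses, and `bijOn_of_invOK` (generators permute the forms).
-/

set_option autoImplicit false

namespace Summit.Ventures.MM22.ProfileCert

/-! ### the generators: matrix algebra of `sigma`, inverse witnesses, bijectivity on the forms -/

section Sigma
open Summit.MatrixMultiplication.OmegaCensus.GF2RankLB Matrix

/-- `mul3` is a 9-bit pattern. -/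
theorem mul3_lt (P X : ℕ) : mul3 P X < 2 ^ 9 := maskOf_lt _ _
/-- `tr3` is a 9-bit pattern. -/
theorem tr3_lt (X : ℕ) : tr3 X < 2 ^ 9 := maskOf_lt _ _
/-- `sigma` is a 9-bit pattern. -/
theorem sigma_lt (P Q t X : ℕ) : sigma P Q t X < 2 ^ 9 := mul3_lt _ _

/-- `mul3` encodes the matrix product. -/
theorem ofBits_mul3 (P X : ℕ) : ofBits 3 3 (mul3 P X) = ofBits 3 3 P * ofBits 3 3 X := ofBits_mulBits 3 3 3 P X
/-- `tr3` encodes the transpose. -/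
theorem ofBits_tr3 (X : ℕ) : ofBits 3 3 (tr3 X) = (ofBits 3 3 X)ᵀ := ofBits_trBits 3 3 X

/-- `ofBits 3 3` is injective below `2^9`. -/
theorem eq_of_ofBits_eq {x y : ℕ} (hx : x < 2 ^ 9) (hy : y < 2 ^ 9) (h : ofBits 3 3 x = ofBits 3 3 y) : x = y := by
  apply Nat.eq_of_testBit_eq
  intro p
  by_cases hp : p < 9
  · have hi : p / 3 < 3 := by omega
    have hj : p % 3 < 3 := Nat.mod_lt _ (by norm_num)
    have := congrFun (congrFun h ⟨p / 3, hi⟩) ⟨p % 3, hj⟩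
    simp only [ofBits_apply, pos, Nat.mod_add_div] at this
    cases hxp : x.testBit p <;> cases hyp : y.testBit p <;> simp_all
  · have h9 : 2 ^ 9 ≤ 2 ^ p := Nat.pow_le_pow_right (by norm_num) (by omega)
    rw [Nat.testBit_lt_two_pow (lt_of_lt_of_le hx h9), Nat.testBit_lt_two_pow (lt_of_lt_of_le hy h9)]

/-- The pattern `0` encodes the zero matrix. -/
theorem ofBits_zero33 : ofBits 3 3 0 = 0 := by
  ext i j; simp [ofBits_apply]

/-- The matrix of `sigma P Q t X`. -/
theorem ofBits_sigma (P Q t X : ℕ) :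
    ofBits 3 3 (sigma P Q t X) = ofBits 3 3 P * (if t = 1 then (ofBits 3 3 X)ᵀ else ofBits 3 3 X) * ofBits 3 3 Q := by
  unfold sigma
  rw [ofBits_mul3, ofBits_mul3]
  split
  · rw [ofBits_tr3]
  · rfl

/-- The inverse map of a generator with inverse witnesses. -/
def MapW.sigmaInv (mp : MapW) (Y : ℕ) : ℕ :=
  if mp.t = 1 then tr3 (mul3 (mul3 mp.Pi Y) mp.Qi) else mul3 (mul3 mp.Pi Y) mp.Qi

/-- The inverse map produces 9-bit patterns. -/
theorem MapW.sigmaInv_lt (mp : MapW) (Y : ℕ) : mp.sigmaInv Y < 2 ^ 9 := by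
  unfold MapW.sigmaInv; split
  · exact tr3_lt _
  · exact mul3_lt _ _

/-- The matrix of the inverse map. -/
theorem MapW.ofBits_sigmaInv (mp : MapW) (Y : ℕ) :
    ofBits 3 3 (mp.sigmaInv Y) = if mp.t = 1 then (ofBits 3 3 mp.Pi * ofBits 3 3 Y * ofBits 3 3 mp.Qi)ᵀ
      else ofBits 3 3 mp.Pi * ofBits 3 3 Y * ofBits 3 3 mp.Qi := by
  unfold MapW.sigmaInv; split
  · rw [ofBits_tr3, ofBits_mul3, ofBits_mul3]
  · rw [ofBits_mul3, ofBits_mul3]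

/-- Unpacking the inverse witnesses. -/
theorem MapW.invOK_spec {mp : MapW} (h : mp.invOK = true) :
    ofBits 3 3 mp.P * ofBits 3 3 mp.Pi = 1 ∧ ofBits 3 3 mp.Pi * ofBits 3 3 mp.P = 1 ∧
    ofBits 3 3 mp.Q * ofBits 3 3 mp.Qi = 1 ∧ ofBits 3 3 mp.Qi * ofBits 3 3 mp.Q = 1 := by
  unfold MapW.invOK at h
  simp only [Bool.and_eq_true, beq_iff_eq] at h
  obtain ⟨⟨⟨h1, h2⟩, h3⟩, h4⟩ := h
  exact ⟨ofBits_eq_one_of_mulBits_eq h1, ofBits_eq_one_of_mulBits_eq h2, ofBits_eq_one_of_mulBits_eq h3,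
    ofBits_eq_one_of_mulBits_eq h4⟩

/-- Left inverse on 9-bit patterns. -/
theorem MapW.sigmaInv_sigma {mp : MapW} (h : mp.invOK = true) {X : ℕ} (hX : X < 2 ^ 9) :
    mp.sigmaInv (mp.sigma X) = X := by
  obtain ⟨_, h2, h3, _⟩ := MapW.invOK_spec h
  apply eq_of_ofBits_eq (mp.sigmaInv_lt _) hX
  try unfold MapW.sigma
  rw [MapW.ofBits_sigmaInv, ofBits_sigma]
  by_cases ht : mp.t = 1
  · simp only [ht, if_true]
    rw [show ofBits 3 3 mp.Pi * (ofBits 3 3 mp.P * (ofBits 3 3 X)ᵀ * ofBits 3 3 mp.Q) * ofBits 3 3 mp.Qi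
        = (ofBits 3 3 mp.Pi * ofBits 3 3 mp.P) * (ofBits 3 3 X)ᵀ * (ofBits 3 3 mp.Q * ofBits 3 3 mp.Qi) by
          simp only [Matrix.mul_assoc], h2, h3, Matrix.one_mul, Matrix.mul_one, Matrix.transpose_transpose]
  · simp only [ht, if_false]
    rw [show ofBits 3 3 mp.Pi * (ofBits 3 3 mp.P * ofBits 3 3 X * ofBits 3 3 mp.Q) * ofBits 3 3 mp.Qi
        = (ofBits 3 3 mp.Pi * ofBits 3 3 mp.P) * ofBits 3 3 X * (ofBits 3 3 mp.Q * ofBits 3 3 mp.Qi) by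
          simp only [Matrix.mul_assoc], h2, h3, Matrix.one_mul, Matrix.mul_one]

/-- Right inverse on 9-bit patterns. -/
theorem MapW.sigma_sigmaInv {mp : MapW} (h : mp.invOK = true) {Y : ℕ} (hY : Y < 2 ^ 9) :
    mp.sigma (mp.sigmaInv Y) = Y := by
  obtain ⟨h1, _, _, h4⟩ := MapW.invOK_spec h
  apply eq_of_ofBits_eq (sigma_lt _ _ _ _) hY
  try unfold MapW.sigma
  rw [ofBits_sigma, MapW.ofBits_sigmaInv]
  by_cases ht : mp.t = 1
  · simp only [ht, if_true, Matrix.transpose_transpose]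
    rw [show ofBits 3 3 mp.P * (ofBits 3 3 mp.Pi * ofBits 3 3 Y * ofBits 3 3 mp.Qi) * ofBits 3 3 mp.Q
        = (ofBits 3 3 mp.P * ofBits 3 3 mp.Pi) * ofBits 3 3 Y * (ofBits 3 3 mp.Qi * ofBits 3 3 mp.Q) by
          simp only [Matrix.mul_assoc], h1, h4, Matrix.one_mul, Matrix.mul_one]
  · simp only [ht, if_false]
    rw [show ofBits 3 3 mp.P * (ofBits 3 3 mp.Pi * ofBits 3 3 Y * ofBits 3 3 mp.Qi) * ofBits 3 3 mp.Q
        = (ofBits 3 3 mp.P * ofBits 3 3 mp.Pi) * ofBits 3 3 Y * (ofBits 3 3 mp.Qi * ofBits 3 3 mp.Q) by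
          simp only [Matrix.mul_assoc], h1, h4, Matrix.one_mul, Matrix.mul_one]

/-- Generators fix the zero pattern. -/
theorem MapW.sigma_zero (mp : MapW) : mp.sigma 0 = 0 := by
  apply eq_of_ofBits_eq (sigma_lt _ _ _ _) (by norm_num)
  try unfold MapW.sigma
  rw [ofBits_sigma, ofBits_zero33]
  split <;> simp

/-- Inverse generators fix the zero pattern. -/
theorem MapW.sigmaInv_zero (mp : MapW) : mp.sigmaInv 0 = 0 := by
  apply eq_of_ofBits_eq (mp.sigmaInv_lt _) (by norm_num)
  rw [MapW.ofBits_sigmaInv, ofBits_zero33]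
  split <;> simp

/-- A generator with inverse witnesses permutes the forms. -/
theorem bijOn_of_invOK {mp : MapW} (h : mp.invOK = true) : Set.BijOn mp.sigma (↑forms) (↑forms) := by
  have hNF : ∀ x, x ∈ forms ↔ x ≠ 0 ∧ x < 2 ^ 9 := by
    intro x; rw [mem_forms, NF]; omega
  refine ⟨fun x hx => ?_, fun x hx y hy hxy => ?_, fun y hy => ?_⟩
  · rw [Finset.mem_coe, hNF] at hx ⊢
    refine ⟨fun h0 => hx.1 ?_, sigma_lt _ _ _ _⟩
    have := MapW.sigmaInv_sigma h hx.2
    rw [show mp.sigma x = 0 from h0, MapW.sigmaInv_zero] at this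
    exact this.symm
  · rw [Finset.mem_coe, hNF] at hx hy
    have h1 := MapW.sigmaInv_sigma h hx.2
    have h2 := MapW.sigmaInv_sigma h hy.2
    rw [hxy] at h1
    exact h1.symm.trans h2
  · rw [Finset.mem_coe, hNF] at hy
    refine ⟨mp.sigmaInv y, ?_, MapW.sigma_sigmaInv h hy.2⟩
    rw [Finset.mem_coe, hNF]
    refine ⟨fun h0 => hy.1 ?_, mp.sigmaInv_lt _⟩
    have := MapW.sigma_sigmaInv h hy.2
    rw [h0, MapW.sigma_zero] at this
    exact this.symm

end Sigma

end Summit.Ventures.MM22.ProfileCert
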